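import Mathlib
import Literature.Dynamics.Contraction.ComplexConeContraction

/-!
# Coarse-graining preserves Rugh's cone `ℂⁿ₊` and Dubois' cone-mapping property

Helper lemmas for item stmt-CriticalPhenomena-8879 (`UniformConeCondition`, route `CardyComplexCone`),
kernel-certifying §2.3 of the evidence file `UniformConeCondition-evidence.md`: aggregating the rows and
columns of a complex kernel with NONNEGATIVE weights (binning fine patterns into coarse ones, with their
conditional masses as weights) maps Rugh's cone `ℂⁿ₊ = {v : ∀ k l, Re(v_k v̄_l) ≥ 0}` into itself and its
printed interior into the interior; hence a kernel `A` with Dubois' property `A(ℂⁿ₊ ∖ 0) ⊆ Int ℂ₊`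
(Dubois 2009, Thm 1.1 / Prop. 3.3 — the hypothesis produced by `ComplexConeContraction`) keeps that
property after any such coarse-graining `P A W`. Contrapositive (used in the evidence): a coarse-grained
Monte-Carlo kernel violating Dubois' condition grossly cannot come from a fine kernel satisfying it.
Pure linear algebra over `Literature.Dynamics.Contraction.rughCone / rughConeInt`.
-/

noncomputable section

open scoped ComplexConjugate
open Matrix

namespace Summit.CriticalPhenomena.CardyFormulaZ2.Theorems.ConeCoarseGraining

open Literature.Dynamics.Contraction (rughCone rughConeInt)

/-- Real part of the Hermitian pairing of two nonnegative aggregations: for real matrices `P`, `Q` and a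
complex vector `x`, `Re((P x)_i · conj((Q x)_j)) = Σ_k Σ_l P_ik Q_jl Re(x_k x̄_l)`. -/
theorem re_mulVec_mul_conj_mulVec {m m' n : ℕ} (P : Matrix (Fin m) (Fin n) ℝ)
    (Q : Matrix (Fin m') (Fin n) ℝ) (x : Fin n → ℂ) (i : Fin m) (j : Fin m') :
    ((P.map ((↑) : ℝ → ℂ)).mulVec x i * conj ((Q.map ((↑) : ℝ → ℂ)).mulVec x j)).re =
      ∑ k, ∑ l, P i k * Q j l * (x k * conj (x l)).re := by
  have h1 : (P.map ((↑) : ℝ → ℂ)).mulVec x i = ∑ k, (P i k : ℂ) * x k := by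
    simp [Matrix.mulVec, dotProduct]
  have h2 : conj ((Q.map ((↑) : ℝ → ℂ)).mulVec x j) = ∑ l, (Q j l : ℂ) * conj (x l) := by
    simp [Matrix.mulVec, dotProduct, map_sum]
  rw [h1, h2, Finset.sum_mul]
  simp_rw [Finset.mul_sum]
  rw [Complex.re_sum]
  refine Finset.sum_congr rfl fun k _ => ?_
  rw [Complex.re_sum]
  refine Finset.sum_congr rfl fun l _ => ?_
  have : ((P i k : ℂ) * x k * ((Q j l : ℂ) * conj (x l)) : ℂ) = ↑(P i k * Q j l) * (x k * conj (x l)) := by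
    push_cast; ring
  rw [this, Complex.re_ofReal_mul]

/-- **Nonnegative aggregation preserves Rugh's cone.** If `P ≥ 0` entrywise and `x ∈ ℂⁿ₊` then
`P x ∈ ℂ^m₊`. -/
theorem mulVec_mem_rughCone_of_nonneg {m n : ℕ} (P : Matrix (Fin m) (Fin n) ℝ) (hP : ∀ i k, 0 ≤ P i k)
    {x : Fin n → ℂ} (hx : x ∈ rughCone n) : (P.map ((↑) : ℝ → ℂ)).mulVec x ∈ rughCone m := by
  intro i j
  rw [re_mulVec_mul_conj_mulVec]
  exact Finset.sum_nonneg fun k _ => Finset.sum_nonneg fun l _ =>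
    mul_nonneg (mul_nonneg (hP i k) (hP j l)) (hx k l)

/-- **Nonnegative aggregation with no empty bin preserves the printed interior.** If `P ≥ 0` entrywise,
every row of `P` has a positive entry, and `x ∈ Int ℂⁿ₊`, then `P x ∈ Int ℂ^m₊`. -/
theorem mulVec_mem_rughConeInt_of_nonneg {m n : ℕ} (P : Matrix (Fin m) (Fin n) ℝ) (hP : ∀ i k, 0 ≤ P i k)
    (hrow : ∀ i, ∃ k, 0 < P i k) {x : Fin n → ℂ} (hx : x ∈ rughConeInt n) :
    (P.map ((↑) : ℝ → ℂ)).mulVec x ∈ rughConeInt m := by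
  intro i j
  rw [re_mulVec_mul_conj_mulVec]
  obtain ⟨k₀, hk₀⟩ := hrow i
  obtain ⟨l₀, hl₀⟩ := hrow j
  have hterm : ∀ k l, 0 ≤ P i k * P j l * (x k * conj (x l)).re := fun k l =>
    mul_nonneg (mul_nonneg (hP i k) (hP j l)) (hx k l).le
  calc (0 : ℝ) < P i k₀ * P j l₀ * (x k₀ * conj (x l₀)).re :=
        mul_pos (mul_pos hk₀ hl₀) (hx k₀ l₀)
    _ ≤ ∑ l, P i k₀ * P j l * (x k₀ * conj (x l)).re :=
        Finset.single_le_sum (f := fun l => P i k₀ * P j l * (x k₀ * conj (x l)).re)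
          (fun l _ => hterm k₀ l) (Finset.mem_univ l₀)
    _ ≤ ∑ k, ∑ l, P i k * P j l * (x k * conj (x l)).re :=
        Finset.single_le_sum (f := fun k => ∑ l, P i k * P j l * (x k * conj (x l)).re)
          (fun k _ => Finset.sum_nonneg fun l _ => hterm k l) (Finset.mem_univ k₀)

/-- **Coarse-graining preserves Dubois' cone-mapping property.** Let the complex kernel `A` map
`ℂⁿ₊ ∖ 0` into `Int ℂ^{n'}₊` (Dubois 2009, Thm 1.1 / Prop. 3.3: for square `A` this is the four-index
inequality `Re(ā_kp a_lq + ā_kq a_lp) > |a_kp a_lq − a_kq a_lp|`). Then for every nonnegative row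
aggregation `P` without empty bins and every nonnegative column aggregation `W`, the coarse kernel
`P A W` maps every `x ∈ ℂ^p₊` with `W x ≠ 0` into `Int ℂ^m₊`. -/
theorem coarseGraining_mapsTo_rughConeInt {m n' n p : ℕ} (A : Matrix (Fin n') (Fin n) ℂ)
    (hA : ∀ v ∈ rughCone n, v ≠ 0 → A.mulVec v ∈ rughConeInt n')
    (P : Matrix (Fin m) (Fin n') ℝ) (hP : ∀ i k, 0 ≤ P i k) (hrow : ∀ i, ∃ k, 0 < P i k)
    (W : Matrix (Fin n) (Fin p) ℝ) (hW : ∀ i k, 0 ≤ W i k)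
    {x : Fin p → ℂ} (hx : x ∈ rughCone p) (hWx : (W.map ((↑) : ℝ → ℂ)).mulVec x ≠ 0) :
    ((P.map ((↑) : ℝ → ℂ)) * A * (W.map ((↑) : ℝ → ℂ))).mulVec x ∈ rughConeInt m := by
  rw [← Matrix.mulVec_mulVec, ← Matrix.mulVec_mulVec]
  exact mulVec_mem_rughConeInt_of_nonneg P hP hrow
    (hA _ (mulVec_mem_rughCone_of_nonneg W hW hx) hWx)

/-- The same with the conclusion in the weaker cone `ℂ^m₊` and no condition on the bins of `P`:
coarse-graining a Dubois kernel never produces a vector outside Rugh's cone. -/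
theorem coarseGraining_mapsTo_rughCone {m n' n p : ℕ} (A : Matrix (Fin n') (Fin n) ℂ)
    (hA : ∀ v ∈ rughCone n, v ≠ 0 → A.mulVec v ∈ rughConeInt n')
    (P : Matrix (Fin m) (Fin n') ℝ) (hP : ∀ i k, 0 ≤ P i k)
    (W : Matrix (Fin n) (Fin p) ℝ) (hW : ∀ i k, 0 ≤ W i k)
    {x : Fin p → ℂ} (hx : x ∈ rughCone p) :
    ((P.map ((↑) : ℝ → ℂ)) * A * (W.map ((↑) : ℝ → ℂ))).mulVec x ∈ rughCone m := by
  rw [← Matrix.mulVec_mulVec, ← Matrix.mulVec_mulVec]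
  by_cases hWx : (W.map ((↑) : ℝ → ℂ)).mulVec x = 0
  · rw [hWx, Matrix.mulVec_zero, Matrix.mulVec_zero]
    intro k l; simp
  · exact mulVec_mem_rughCone_of_nonneg P hP fun k l =>
      (hA _ (mulVec_mem_rughCone_of_nonneg W hW hx) hWx k l).le

end Summit.CriticalPhenomena.CardyFormulaZ2.Theorems.ConeCoarseGraining

end
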